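import Summits.CriticalPhenomena.CardyFormulaZ2.Theorems.CardyMagicRigidityPinchResamplingDefsV4
import Summits.CriticalPhenomena.CardyFormulaZ2.Theorems.CardyMagicRigidityNestingRigidityPinchLocality
import HarnessLib

/-!
# The hook-up probability of a ball given its exterior reads only the blobs of the collar touching the inner layer

Crux `Summit.CriticalPhenomena.CardyFormulaZ2.Theses.CardyMagicRigidity.NestingRigidity`
(stmt-CriticalPhenomena-4835), line `pinch-resampling` v4, helper of stub S11 `stub_neckHookupCoarseT : NeckHookupCoarseT`
(coarse measurability of the hook-up probability `g^𝕋_{x,s} = tHookProb x s` of the ball `Λ_s(x)` given its exterior,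
`…PinchResamplingDefsV4`).  Bricks B1 (locality) and B2 (structure) of the S11 brief, sorry-free:

* §1 (`NeckCoarse.*`, generic over a graph `G`, hole `I`, big region `O`; shared with the `ℤ²` twin S12): blobs
  `blobOf H A v` are the classes of the equivalence relation `PathIn H A` (`blobOf_eq_of_mem`), they and the coarse
  datum `coarseBlobs` only read the edges of `H` inside the annulus (`blobOf_congr`, `coarseBlobs_congr`).
* §2 (`NeckCoarse.*`, generic, SITE configurations `η` with open graph `siteOpenGraph G η`): **the structure lemma**
  `hookedUp_iff_of_blobs_agree` — the hook-up `HookedUp G (siteOpenGraph G η) I O` of the annulus `O ∖ I` depends on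
  the configuration `η` only through (a) the colours of the hole `I`, (b) the colours of the inner layer, and (c) for
  every OPEN inner-layer vertex `v`, the FOOTPRINT `blobOf _ (O ∖ I) v ∩ innerLayer` of its blob on the inner layer and
  its CROSSING FLAG (whether the blob meets the outer layer).  Proof: an open path of `O` decomposes into segments in
  the hole and segments in the annulus; each annulus segment lies in one blob, entered and left through inner-layer
  vertices (`pathIn_transfer`), so it can be re-routed inside the blob with the same footprint of the other
  configuration.  Nothing else of the collar matters (closed sites, blobs not touching the inner layer, the geometry of
  a blob away from the inner layer); in particular `g` is NOT a function of coarse traces alone but IS a function of the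
  fine blob datum (typing note `S10-typing.md` §2, first two bullets).
* §3 (site `𝕋`): `tColourGraph ω true = siteOpenGraph triGraph ω`; B1 `tCoarse_congr` (probe 2 of the vocabulary file:
  the coarse datum reads only the collar `Λ_{2s}(x) ∖ Λ_s(x)`), `tHookProb_congr` (so does `g^𝕋`), hence the deviation
  event of `NeckHookupCoarseT` is determined by the finite collar and MEASURABLE for every `G` (`measurableSet_neckBad`:
  the outer measure in the stub statement is an honest probability); B2 `tHookProb_eq_of_blobs_agree` (registered
  anchor): two exteriors with the same open inner-layer sites, the same fine footprints and the same crossing flags of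
  the blobs of those sites have the same `g^𝕋`, for EVERY interior sample (the splices have the same hook-up).
-/

noncomputable section

namespace Summit.CriticalPhenomena.CardyFormulaZ2.Cruxes.NestingRigidity.PinchResampling

open MeasureTheory Set Literature.Probability.Percolation Literature.Probability.LatticeModels

namespace NeckCoarse

variable {V : Type*}

/-! ## §1 Blobs are equivalence classes and read only the edges of the annulus -/

section Blobs

variable {H H' : SimpleGraph V} {A : Set V} {v w : V}

/-- Membership in a blob is a path inside the region. -/
theorem mem_blobOf : w ∈ blobOf H A v ↔ PathIn H A v w := Iff.rfl

/-- A vertex of the region lies in its own blob. -/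
theorem self_mem_blobOf (hv : v ∈ A) : v ∈ blobOf H A v := PathIn.refl hv

/-- Blobs lie inside the region. -/
theorem blobOf_subset (H : SimpleGraph V) (A : Set V) (v : V) : blobOf H A v ⊆ A := fun _ hw ↦ PathIn.right_mem hw

/-- **Blobs are the classes of an equivalence relation**: the blob of any of its members is the blob itself. -/
theorem blobOf_eq_of_mem (hw : w ∈ blobOf H A v) : blobOf H A w = blobOf H A v := by
  ext z
  exact ⟨fun hz ↦ PathIn.trans hw hz, fun hz ↦ PathIn.trans (PathIn.symm hw) hz⟩

/-- Blobs only read the edges of `H` between vertices of the region. -/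
theorem blobOf_congr (h : ∀ a ∈ A, ∀ b ∈ A, (H.Adj a b ↔ H'.Adj a b)) (v : V) : blobOf H A v = blobOf H' A v := by
  ext w
  exact pathIn_congr_of_adj_iff h v w

/-- **The coarse blob datum only reads the edges of `H` inside the annulus `O ∖ I`.** -/
theorem coarseBlobs_congr (G : SimpleGraph (Site 2)) {H H' : SimpleGraph (Site 2)} {I O : Set (Site 2)}
    (h : ∀ a ∈ O \ I, ∀ b ∈ O \ I, (H.Adj a b ↔ H'.Adj a b)) (N : Site 2 → ℤ) (ℓ lam : ℕ) (o : Site 2) :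
    coarseBlobs G H I O N ℓ lam o = coarseBlobs G H' I O N ℓ lam o := by
  simp only [coarseBlobs, blobOf_congr h]

end Blobs

/-! ## §2 The structure lemma: the hook-up reads the exterior only through footprints and flags -/

section Structure

variable {G : SimpleGraph V} {I O : Set V} {η η' : Set V}

/-- Two site configurations with the same colours on `A` have the same open edges inside `A`. -/
theorem siteOpenGraph_adj_iff_of_agree {A : Set V} (h : ∀ v ∈ A, (v ∈ η ↔ v ∈ η')) :
    ∀ a ∈ A, ∀ b ∈ A, ((siteOpenGraph G η).Adj a b ↔ (siteOpenGraph G η').Adj a b) := by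
  intro a ha b hb
  simp only [siteOpenGraph_adj, h a ha, h b hb]

/-- A non-trivial open path starts at an open site. -/
theorem mem_of_pathIn_ne {A : Set V} {u v : V} (hp : PathIn (siteOpenGraph G η) A u v) (huv : u ≠ v) : u ∈ η := by
  obtain ⟨b, hb⟩ := exists_adj_of_pathIn_ne hp huv
  exact ((siteOpenGraph_adj G η u b).1 hb).2.1

/-- An open path from a closed site is trivial. -/
theorem eq_of_pathIn_of_notMem {A : Set V} {u v : V} (hp : PathIn (siteOpenGraph G η) A u v) (hu : u ∉ η) : v = u := by
  by_contra h
  exact hu (mem_of_pathIn_ne hp (Ne.symm h))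

/-- An annulus vertex adjacent to the hole lies on the inner layer. -/
theorem mem_innerLayer_of_adj {b c : V} (hb : b ∈ O \ I) (hc : c ∈ I) (hbc : G.Adj b c) : b ∈ innerLayer G I O :=
  ⟨hb, c, hc, hbc⟩

/-- **Path transfer.**  Let `η, η'` agree on the hole `I` and on the inner layer, and let the inner-layer footprint
of the `η`-blob of every open inner-layer vertex be contained in its `η'`-blob.  Then an `η`-open path of the big
region `O` from an inner-layer vertex `u` to `z` yields: if `z` is in the hole, an `η'`-open path of `O` from `u`
to `z`; if not, an `η'`-open path of `O` from `u` to some inner-layer vertex `v` whose `η`-blob contains `z`. -/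
theorem pathIn_transfer (hI : ∀ v ∈ I, (v ∈ η ↔ v ∈ η')) (hcol : ∀ v ∈ innerLayer G I O, (v ∈ η ↔ v ∈ η'))
    (hfp : ∀ v ∈ innerLayer G I O, v ∈ η →
      blobOf (siteOpenGraph G η) (O \ I) v ∩ innerLayer G I O ⊆ blobOf (siteOpenGraph G η') (O \ I) v)
    {u z : V} (hu : u ∈ innerLayer G I O) (hp : PathIn (siteOpenGraph G η) O u z) :
    (z ∈ I → PathIn (siteOpenGraph G η') O u z) ∧
      (z ∉ I → ∃ v ∈ innerLayer G I O, PathIn (siteOpenGraph G η') O u v ∧ PathIn (siteOpenGraph G η) (O \ I) v z) := by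
  obtain ⟨huO, p⟩ := hp
  induction p with
  | refl => exact ⟨fun h ↦ (hu.1.2 h).elim, fun _ ↦ ⟨u, hu, PathIn.refl huO, PathIn.refl hu.1⟩⟩
  | @tail b c hub hbc ih =>
    obtain ⟨hbc, hcO⟩ := hbc
    obtain ⟨hG, hbη, hcη⟩ := (siteOpenGraph_adj G η b c).1 hbc
    have hbO : b ∈ O := PathIn.right_mem (show PathIn (siteOpenGraph G η) O u b from ⟨huO, hub⟩)
    by_cases hbI : b ∈ I
    · have hb' : PathIn (siteOpenGraph G η') O u b := ih.1 hbI
      by_cases hcI : c ∈ I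
      · refine ⟨fun _ ↦ hb'.tail ((siteOpenGraph_adj G η' b c).2 ⟨hG, (hI b hbI).1 hbη, (hI c hcI).1 hcη⟩) hcO,
          fun h ↦ (h hcI).elim⟩
      · have hcL : c ∈ innerLayer G I O := mem_innerLayer_of_adj ⟨hcO, hcI⟩ hbI hG.symm
        refine ⟨fun h ↦ (hcI h).elim, fun _ ↦ ⟨c, hcL, ?_, PathIn.refl ⟨hcO, hcI⟩⟩⟩
        exact hb'.tail ((siteOpenGraph_adj G η' b c).2 ⟨hG, (hI b hbI).1 hbη, (hcol c hcL).1 hcη⟩) hcO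
    · obtain ⟨v, hvL, hv', hvb⟩ := ih.2 hbI
      by_cases hcI : c ∈ I
      · have hbL : b ∈ innerLayer G I O := mem_innerLayer_of_adj ⟨hbO, hbI⟩ hcI hG
        have hvη : v ∈ η := by
          by_cases hvb' : v = b
          · exact hvb' ▸ hbη
          · exact mem_of_pathIn_ne hvb hvb'
        have hb'' : PathIn (siteOpenGraph G η') (O \ I) v b := hfp v hvL hvη ⟨hvb, hbL⟩
        refine ⟨fun _ ↦ ?_, fun h ↦ (h hcI).elim⟩
        exact (hv'.trans (hb''.mono Set.sdiff_subset)).tail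
          ((siteOpenGraph_adj G η' b c).2 ⟨hG, (hcol b hbL).1 hbη, (hI c hcI).1 hcη⟩) hcO
      · exact ⟨fun h ↦ (hcI h).elim, fun _ ↦ ⟨v, hvL, hv', hvb.tail hbc ⟨hcO, hcI⟩⟩⟩

/-- Consequence: open paths of `O` between inner-layer vertices transfer from `η` to `η'`. -/
theorem pathIn_of_blobs_le (hI : ∀ v ∈ I, (v ∈ η ↔ v ∈ η')) (hcol : ∀ v ∈ innerLayer G I O, (v ∈ η ↔ v ∈ η'))
    (hfp : ∀ v ∈ innerLayer G I O, v ∈ η →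
      blobOf (siteOpenGraph G η) (O \ I) v ∩ innerLayer G I O ⊆ blobOf (siteOpenGraph G η') (O \ I) v)
    {u z : V} (hu : u ∈ innerLayer G I O) (hz : z ∈ innerLayer G I O) (hp : PathIn (siteOpenGraph G η) O u z) :
    PathIn (siteOpenGraph G η') O u z := by
  obtain ⟨v, hvL, hv', hvz⟩ := (pathIn_transfer hI hcol hfp hu hp).2 hz.1.2
  by_cases hvη : v ∈ η
  · exact hv'.trans ((hfp v hvL hvη ⟨hvz, hz⟩ : PathIn _ (O \ I) v z).mono Set.sdiff_subset)
  · rwa [eq_of_pathIn_of_notMem hvz hvη]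

/-- Crossings transfer from `η` to `η'` when, in addition, crossing flags are preserved. -/
theorem isCrossing_of_blobs_le
    (hflag : ∀ v ∈ innerLayer G I O, v ∈ η → (∃ w ∈ blobOf (siteOpenGraph G η) (O \ I) v, w ∈ outerLayer G I O) →
      ∃ w ∈ blobOf (siteOpenGraph G η') (O \ I) v, w ∈ outerLayer G I O)
    {v : V} (hv : IsCrossing G (siteOpenGraph G η) I O v) : IsCrossing G (siteOpenGraph G η') I O v := by
  obtain ⟨hvL, w, hw, hp⟩ := hv
  by_cases hvη : v ∈ η
  · obtain ⟨w', hw', hw'o⟩ := hflag v hvL hvη ⟨w, hp, hw⟩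
    exact ⟨hvL, w', hw'o, hw'⟩
  · have hwv : w = v := eq_of_pathIn_of_notMem hp hvη
    subst hwv
    exact ⟨hvL, w, hw, PathIn.refl hvL.1⟩

/-- One direction of the structure lemma. -/
theorem hookedUp_of_blobs_agree (hI : ∀ v ∈ I, (v ∈ η ↔ v ∈ η'))
    (h : ∀ v ∈ innerLayer G I O, (v ∈ η ↔ v ∈ η') ∧ (v ∈ η →
      blobOf (siteOpenGraph G η) (O \ I) v ∩ innerLayer G I O =
          blobOf (siteOpenGraph G η') (O \ I) v ∩ innerLayer G I O ∧
        ((∃ w ∈ blobOf (siteOpenGraph G η) (O \ I) v, w ∈ outerLayer G I O) ↔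
          ∃ w ∈ blobOf (siteOpenGraph G η') (O \ I) v, w ∈ outerLayer G I O)))
    (hH : HookedUp G (siteOpenGraph G η') I O) : HookedUp G (siteOpenGraph G η) I O := by
  have hcol : ∀ v ∈ innerLayer G I O, (v ∈ η ↔ v ∈ η') := fun v hv ↦ (h v hv).1
  have hcol' : ∀ v ∈ innerLayer G I O, (v ∈ η' ↔ v ∈ η) := fun v hv ↦ (hcol v hv).symm
  have hI' : ∀ v ∈ I, (v ∈ η' ↔ v ∈ η) := fun v hv ↦ (hI v hv).symm
  intro v w hv hw
  have hv' : IsCrossing G (siteOpenGraph G η') I O v :=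
    isCrossing_of_blobs_le (fun u hu huη ↦ ((h u hu).2 huη).2.1) hv
  have hw' : IsCrossing G (siteOpenGraph G η') I O w :=
    isCrossing_of_blobs_le (fun u hu huη ↦ ((h u hu).2 huη).2.1) hw
  refine pathIn_of_blobs_le hI' hcol' (fun u hu huη' ↦ ?_) hv.1 hw.1 (hH v w hv' hw')
  have huη : u ∈ η := (hcol u hu).2 huη'
  rw [← ((h u hu).2 huη).1]
  exact inter_subset_left

/-- **The structure lemma (generic).**  If two site configurations agree on the hole `I` and on the inner layer of the
annulus `O ∖ I`, and every open inner-layer vertex has, in both, a blob with the same footprint on the inner layer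
and the same crossing flag, then the annulus is hooked up in one iff it is hooked up in the other. -/
theorem hookedUp_iff_of_blobs_agree (hI : ∀ v ∈ I, (v ∈ η ↔ v ∈ η'))
    (h : ∀ v ∈ innerLayer G I O, (v ∈ η ↔ v ∈ η') ∧ (v ∈ η →
      blobOf (siteOpenGraph G η) (O \ I) v ∩ innerLayer G I O =
          blobOf (siteOpenGraph G η') (O \ I) v ∩ innerLayer G I O ∧
        ((∃ w ∈ blobOf (siteOpenGraph G η) (O \ I) v, w ∈ outerLayer G I O) ↔
          ∃ w ∈ blobOf (siteOpenGraph G η') (O \ I) v, w ∈ outerLayer G I O))) :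
    HookedUp G (siteOpenGraph G η) I O ↔ HookedUp G (siteOpenGraph G η') I O := by
  refine ⟨hookedUp_of_blobs_agree (fun v hv ↦ (hI v hv).symm) (fun v hv ↦ ⟨(h v hv).1.symm, fun hvη' ↦ ?_⟩),
    hookedUp_of_blobs_agree hI h⟩
  obtain ⟨h1, h2⟩ := (h v hv).2 (((h v hv).1).2 hvη')
  exact ⟨h1.symm, h2.symm⟩

end Structure

end NeckCoarse

/-! ## §3 Site percolation on `𝕋`: locality of `tCoarse`, `tHookProb`, measurability of the deviation event, and B2 -/

section SiteT

/-- The open colour graph of `ω` is the open graph of `ω`. -/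
theorem tColourGraph_true (ω : SiteConfig (Site 2)) : tColourGraph ω true = siteOpenGraph triGraph ω := by
  have h : {u : Site 2 | (u ∈ ω) = true} = ω := by ext u; simp
  rw [tColourGraph, h]

/-- **B1, probe 2 of the vocabulary file: `tCoarse` reads only the colours of the collar `Λ_{2s}(x) ∖ Λ_s(x)`**, hence is
exterior-determined for the ball `Λ_s(x)`. -/
theorem tCoarse_congr (ℓ lam s : ℕ) (x o : Site 2) {ω ω' : SiteConfig (Site 2)}
    (h : ω ∩ (tBall x (2 * s) \ tBall x s) = ω' ∩ (tBall x (2 * s) \ tBall x s)) :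
    tCoarse ℓ lam s x o ω = tCoarse ℓ lam s x o ω' :=
  NeckCoarse.coarseBlobs_congr triGraph (tColourGraph_adj_iff_of_inter_eq h true) triNorm ℓ lam o

/-- Splicing a sample `ξ` into the ball: two exteriors agreeing on the collar give splices agreeing on `Λ_{2s}(x)`. -/
theorem splice_inter_tBall_eq {x : Site 2} {s : ℕ} {ω ω' : SiteConfig (Site 2)}
    (h : ω ∩ (tBall x (2 * s) \ tBall x s) = ω' ∩ (tBall x (2 * s) \ tBall x s)) (ξ : SiteConfig (Site 2)) :
    (ξ ∩ tBall x s ∪ ω \ tBall x s) ∩ tBall x (2 * s) = (ξ ∩ tBall x s ∪ ω' \ tBall x s) ∩ tBall x (2 * s) := by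
  ext i
  simp only [mem_inter_iff, mem_union, Set.mem_sdiff]
  by_cases hiK : i ∈ tBall x s
  · simp [hiK]
  · by_cases hiO : i ∈ tBall x (2 * s)
    · have key : i ∈ ω ↔ i ∈ ω' :=
        ⟨fun hi ↦ ((Set.ext_iff.1 h i).1 ⟨hi, hiO, hiK⟩).1, fun hi ↦ ((Set.ext_iff.1 h i).2 ⟨hi, hiO, hiK⟩).1⟩
      simp [hiK, key]
    · simp [hiO]

/-- **B1: `g^𝕋_{x,s} = tHookProb x s` reads only the colours of the collar** (the hook-up event reads `Λ_{2s}(x)`,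
`tHook_determinedBy`, and the interior is resampled). -/
theorem tHookProb_congr (x : Site 2) (s : ℕ) {ω ω' : SiteConfig (Site 2)}
    (h : ω ∩ (tBall x (2 * s) \ tBall x s) = ω' ∩ (tBall x (2 * s) \ tBall x s)) :
    tHookProb x s ω = tHookProb x s ω' := by
  simp only [tHookProb, condProbOff]
  congr 1
  ext ξ
  exact (determinedBy_iff _ _).1 (tHook_determinedBy x x s s) _ _ (splice_inter_tBall_eq h ξ)

/-- **The deviation event of `NeckHookupCoarseT` is determined by the (finite) collar**, for every candidate `G`. -/
theorem determinedBy_neckBad (b : ℝ) (ℓ lam s : ℕ) (x o : Site 2) (G : Set (Set (Site 2)) × Set (Set (Site 2)) → ℝ) :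
    DeterminedBy (TPinch x x s s ∩ {ω | b < |tHookProb x s ω - G (tCoarse ℓ lam s x o ω)|})
      (tBall x (2 * s) \ tBall x s) := by
  refine (tPinch_determinedBy x x s s).inter ?_
  rw [determinedBy_iff]
  intro ω ω' h
  simp only [mem_setOf_eq, tHookProb_congr x s h, tCoarse_congr ℓ lam s x o h]

/-- **Hence the deviation event is measurable** (audit point: the outer measure in the stub statement is the probability
of an honest cylinder event, whatever `G` is). -/
theorem measurableSet_neckBad (b : ℝ) (ℓ lam s : ℕ) (x o : Site 2) (G : Set (Set (Site 2)) × Set (Set (Site 2)) → ℝ) :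
    MeasurableSet (TPinch x x s s ∩ {ω | b < |tHookProb x s ω - G (tCoarse ℓ lam s x o ω)|}) :=
  measurableSet_of_determinedBy_finite ((tBall_finite x (2 * s)).subset Set.sdiff_subset)
    (determinedBy_neckBad b ℓ lam s x o G)

/-- **B2 — the structure lemma for `g^𝕋` (registered anchor).**  Two exteriors `ω, ω'` such that every inner-layer
vertex `v` of the collar `Λ_{2s}(x) ∖ Λ_s(x)` has the same colour in both and, when open, an open blob with the same
footprint on the inner layer and the same crossing flag, have the same hook-up probability `tHookProb x s ω =
tHookProb x s ω'` — indeed the same hook-up for EVERY interior sample.  So `g^𝕋` is a function of the fine blob datum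
{(footprint, flag)} of the open blobs touching the inner layer, and of nothing else in the exterior. -/
theorem tHookProb_eq_of_blobs_agree : ∀ (x : Site 2) (s : ℕ) (ω ω' : SiteConfig (Site 2)), (∀ v ∈ innerLayer triGraph (tBall x s) (tBall x (2 * s)), (v ∈ ω ↔ v ∈ ω') ∧ (v ∈ ω → blobOf (tColourGraph ω true) (tBall x (2 * s) \ tBall x s) v ∩ innerLayer triGraph (tBall x s) (tBall x (2 * s)) = blobOf (tColourGraph ω' true) (tBall x (2 * s) \ tBall x s) v ∩ innerLayer triGraph (tBall x s) (tBall x (2 * s)) ∧ ((∃ w ∈ blobOf (tColourGraph ω true) (tBall x (2 * s) \ tBall x s) v, w ∈ outerLayer triGraph (tBall x s) (tBall x (2 * s))) ↔ ∃ w ∈ blobOf (tColourGraph ω' true) (tBall x (2 * s) \ tBall x s) v, w ∈ outerLayer triGraph (tBall x s) (tBall x (2 * s))))) → tHookProb x s ω = tHookProb x s ω' := by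
  intro x s ω ω' h
  simp only [tHookProb, condProbOff]
  congr 1
  ext ξ
  simp only [mem_setOf_eq, THook, tColourGraph_true]
  set K := tBall x s with hK
  set O := tBall x (2 * s) with hO
  -- the splices agree with `ξ` on the hole and with `ω`, `ω'` on the annulus
  have hann : ∀ (ζ : SiteConfig (Site 2)), ∀ v ∈ O \ K, (v ∈ ξ ∩ K ∪ ζ \ K ↔ v ∈ ζ) := fun ζ v hv ↦ by
    simp [hv.2]
  have hblob : ∀ (ζ : SiteConfig (Site 2)) (v : Site 2),
      blobOf (siteOpenGraph triGraph (ξ ∩ K ∪ ζ \ K)) (O \ K) v = blobOf (tColourGraph ζ true) (O \ K) v := by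
    intro ζ v
    rw [tColourGraph_true]
    exact NeckCoarse.blobOf_congr (NeckCoarse.siteOpenGraph_adj_iff_of_agree (hann ζ)) v
  refine NeckCoarse.hookedUp_iff_of_blobs_agree (fun v hv ↦ by simp [hv]) fun v hv ↦ ?_
  obtain ⟨h1, h2⟩ := h v hv
  rw [hann ω v hv.1, hann ω' v hv.1, hblob ω v, hblob ω' v]
  exact ⟨h1, h2⟩

end SiteT

end Summit.CriticalPhenomena.CardyFormulaZ2.Cruxes.NestingRigidity.PinchResampling

end
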